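import Summits.BirchSwinnertonDyer.BirchSwinnertonDyer.Theorems.Rank2ObservatoryThreeIsoDescentEhat

/-!
# Rank-2 observatory, KERNEL-3ISO (B4-1): the `Ê`-side local kill

HONEST FRAMING: per-curve certified theorems and census instruments; no claim on BSD in rank ≥ 2.

Cell `bsd-rank2-observatory`, cert-1 leg KERNEL-3ISO, generation 10 (the `Ê`-side twin of A5
`ThreeIso.descent_value_ne_of_kill`). Setting: `K ⊇ ℚ(θ)`, `θ² = -3`, every element of `K` of the form
`u + vθ` (`u, v ∈ ℚ`); `Ê = E'_{m,s}` (`m, s ∈ ℤ`) and the `Ê`-side descent value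
`δ(X, Y) = Y - θ(m(X + 4m²/3) + (27s - 4m³)/9)` of Cohen GTM 239 Prop. 8.4.8 (3) / Cohen–Pazuki Prop. 2.2.
After the rescaling `27 δ = Y₂ - θ L₂`, `Y₂ = 27Y`, `X₂ = 9X + 12m²`, `L₂ = 3m X₂ + s₁`, `s₁ = 81s - 12m³`
(`ThreeIso.descent_Ehat_rescale`), the curve equation reads `Y₂² + 3 L₂² = X₂³`. If `[δ(Q)] = [ε]` with
`2ε = e₁ ± e₂θ`, `e₁² + 3e₂² = 4n³` (`n ≠ 0`; the class representatives `ζ^j ∏ π^i π̄^{3-i}` of the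
support law have this shape with `n = ∏ ℓ`), then writing `27δ = ε (r + tθ)³` and taking norms gives
`X₂ = n (r² + 3t²)` and the **torsor**
`F(r, t, v) = e₂ (r³ - 9rt²) + e₁ (3r²t - 3t³) + 6mn (r² + 3t²) v + 2 s₁ v³ = 0` at `(±r, t, 1)`
(`torsor point`, the sign absorbing `±e₂`: the inverse class `[ε̄]` has the same cubic). Hence
(**`ehat_descent_value_ne_of_kill`**): if some rescaling `c · F(l₁ r, l₂ t, l₃ v)` with integer
coefficients `C₁ … C₇` (monomials `r³, r²t, rt², t³, r²v, t²v, v³`) has no zero modulo `p^k` with a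
coordinate equal to `1` — three finite `decide`-able families — then `[δ(Q)] ≠ [ε]` for every affine
`Q ∈ Ê(ℚ)` (and, by the sign, `≠ [ε̄]`). The reduction modulo `p^k` of a rational point
(`exists_zmod_solution₇`) is the seven-monomial copy of A5's `exists_zmod_solution`.

References: [Cohen2007NumberTheoryI] H. Cohen, GTM 239, Prop. 8.4.8 (3), §8.4.4–8.4.5;
[CohenPazuki2009] H. Cohen, F. Pazuki, Acta Arith. 140 (2009), Prop. 2.2, Thm. 4.1 (local images at `Ê`).
-/

set_option linter.dupNamespace false

noncomputable section

open scoped Classical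

open WeierstrassCurve

namespace Summit.BirchSwinnertonDyer.BirchSwinnertonDyer.Rank2Observatory.ThreeIso

open Literature.NumberTheory.EllipticCurves Literature.NumberTheory.EllipticCurves.MordellDescent

section Padic

variable {p : ℕ} [Fact p.Prime]

/-- A `p`-adic point with a non-zero coordinate on a ternary cubic with the seven monomials
`X³, X²Y, XY², Y³, X²Z, Y²Z, Z³` (integer coefficients) reduces, after scaling by a dominating coordinate,
to a solution modulo `p^k` with a coordinate equal to `1`. [folklore] -/
theorem exists_zmod_solution_of_padic₇ (k : ℕ) {C₁ C₂ C₃ C₄ C₅ C₆ C₇ : ℤ} {X Y Z : ℚ_[p]}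
    (hne : X ≠ 0 ∨ Y ≠ 0 ∨ Z ≠ 0)
    (hF : (C₁ : ℚ_[p]) * X ^ 3 + C₂ * (X ^ 2 * Y) + C₃ * (X * Y ^ 2) + C₄ * Y ^ 3 + C₅ * (X ^ 2 * Z)
      + C₆ * (Y ^ 2 * Z) + C₇ * Z ^ 3 = 0) :
    ∃ a b c : ZMod (p ^ k), (a = 1 ∨ b = 1 ∨ c = 1) ∧
      (C₁ : ZMod (p ^ k)) * a ^ 3 + C₂ * (a ^ 2 * b) + C₃ * (a * b ^ 2) + C₄ * b ^ 3 + C₅ * (a ^ 2 * c)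
        + C₆ * (b ^ 2 * c) + C₇ * c ^ 3 = 0 := by
  -- a dominating coordinate `t`
  obtain ⟨t, ht0, htX, htY, htZ, ht⟩ : ∃ t : ℚ_[p], t ≠ 0 ∧ ‖X‖ ≤ ‖t‖ ∧ ‖Y‖ ≤ ‖t‖ ∧ ‖Z‖ ≤ ‖t‖ ∧
      (t = X ∨ t = Y ∨ t = Z) := by
    by_cases h1 : ‖Y‖ ≤ ‖X‖ ∧ ‖Z‖ ≤ ‖X‖
    · refine ⟨X, ?_, le_rfl, h1.1, h1.2, Or.inl rfl⟩
      rintro rfl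
      rcases hne with h | h | h
      · exact h rfl
      · exact h (norm_le_zero_iff.mp (by simpa using h1.1))
      · exact h (norm_le_zero_iff.mp (by simpa using h1.2))
    by_cases h2 : ‖X‖ ≤ ‖Y‖ ∧ ‖Z‖ ≤ ‖Y‖
    · refine ⟨Y, ?_, h2.1, le_rfl, h2.2, Or.inr (Or.inl rfl)⟩
      rintro rfl
      rcases hne with h | h | h
      · exact h (norm_le_zero_iff.mp (by simpa using h2.1))
      · exact h rfl
      · exact h (norm_le_zero_iff.mp (by simpa using h2.2))
    · have hXZ : ‖X‖ ≤ ‖Z‖ := by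
        rw [not_and_or, not_le, not_le] at h1 h2
        rcases h1 with h1 | h1
        · rcases h2 with h2 | h2
          · exact absurd (h1.trans h2) (lt_irrefl _)
          · exact (h1.trans h2).le
        · exact h1.le
      have hYZ : ‖Y‖ ≤ ‖Z‖ := by
        rw [not_and_or, not_le, not_le] at h1 h2
        rcases h2 with h2 | h2
        · rcases h1 with h1 | h1
          · exact absurd (h1.trans h2) (lt_irrefl _)
          · exact (h2.trans h1).le
        · exact h2.le
      refine ⟨Z, ?_, hXZ, hYZ, le_rfl, Or.inr (Or.inr rfl)⟩
      rintro rfl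
      rcases hne with h | h | h
      · exact h (norm_le_zero_iff.mp (by simpa using hXZ))
      · exact h (norm_le_zero_iff.mp (by simpa using hYZ))
      · exact h rfl
  have htn : 0 < ‖t‖ := norm_pos_iff.mpr ht0
  have hle : ∀ {V : ℚ_[p]}, ‖V‖ ≤ ‖t‖ → ‖V / t‖ ≤ 1 := fun hV => by
    rw [norm_div, div_le_one htn]; exact hV
  -- the scaled `ℤ_p`-point
  set a₀ : ℤ_[p] := ⟨X / t, hle htX⟩ with ha₀
  set b₀ : ℤ_[p] := ⟨Y / t, hle htY⟩ with hb₀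
  set c₀ : ℤ_[p] := ⟨Z / t, hle htZ⟩ with hc₀
  have hF' : (C₁ : ℚ_[p]) * (X / t) ^ 3 + C₂ * ((X / t) ^ 2 * (Y / t)) + C₃ * ((X / t) * (Y / t) ^ 2)
      + C₄ * (Y / t) ^ 3 + C₅ * ((X / t) ^ 2 * (Z / t)) + C₆ * ((Y / t) ^ 2 * (Z / t))
      + C₇ * (Z / t) ^ 3 = 0 := by
    field_simp
    linear_combination hF
  have hF₀ : (C₁ : ℤ_[p]) * a₀ ^ 3 + C₂ * (a₀ ^ 2 * b₀) + C₃ * (a₀ * b₀ ^ 2) + C₄ * b₀ ^ 3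
      + C₅ * (a₀ ^ 2 * c₀) + C₆ * (b₀ ^ 2 * c₀) + C₇ * c₀ ^ 3 = 0 := by
    apply PadicInt.ext
    simp only [PadicInt.coe_add, PadicInt.coe_mul, PadicInt.coe_pow, PadicInt.coe_intCast,
      PadicInt.coe_zero]
    exact hF'
  have h1 : ∀ {V : ℚ_[p]} (hV : ‖V / t‖ ≤ 1), t = V →
      PadicInt.toZModPow k (⟨V / t, hV⟩ : ℤ_[p]) = 1 := by
    intro V hV htV
    have : (⟨V / t, hV⟩ : ℤ_[p]) = (1 : ℤ_[p]) := by
      apply PadicInt.ext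
      show V / t = ((1 : ℤ_[p]) : ℚ_[p])
      rw [PadicInt.coe_one, ← htV]
      exact div_self ht0
    rw [this, map_one]
  refine ⟨PadicInt.toZModPow k a₀, PadicInt.toZModPow k b₀, PadicInt.toZModPow k c₀, ?_, ?_⟩
  · rcases ht with h | h | h
    · exact Or.inl (h1 _ h)
    · exact Or.inr (Or.inl (h1 _ h))
    · exact Or.inr (Or.inr (h1 _ h))
  · have := congrArg (PadicInt.toZModPow k) hF₀
    simp only [map_add, map_mul, map_pow, map_intCast, map_zero] at this
    exact this

/-- A rational point with a non-zero coordinate on a seven-monomial ternary cubic (integer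
coefficients) gives a solution modulo `p^k` with a coordinate equal to `1`. [folklore] -/
theorem exists_zmod_solution₇ (k : ℕ) {C₁ C₂ C₃ C₄ C₅ C₆ C₇ : ℤ} {X Y Z : ℚ}
    (hne : X ≠ 0 ∨ Y ≠ 0 ∨ Z ≠ 0)
    (hF : (C₁ : ℚ) * X ^ 3 + C₂ * (X ^ 2 * Y) + C₃ * (X * Y ^ 2) + C₄ * Y ^ 3 + C₅ * (X ^ 2 * Z)
      + C₆ * (Y ^ 2 * Z) + C₇ * Z ^ 3 = 0) :
    ∃ a b c : ZMod (p ^ k), (a = 1 ∨ b = 1 ∨ c = 1) ∧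
      (C₁ : ZMod (p ^ k)) * a ^ 3 + C₂ * (a ^ 2 * b) + C₃ * (a * b ^ 2) + C₄ * b ^ 3 + C₅ * (a ^ 2 * c)
        + C₆ * (b ^ 2 * c) + C₇ * c ^ 3 = 0 := by
  refine exists_zmod_solution_of_padic₇ k (X := (X : ℚ_[p])) (Y := (Y : ℚ_[p])) (Z := (Z : ℚ_[p]))
    ?_ ?_
  · rcases hne with h | h | h
    · exact Or.inl (by exact_mod_cast h)
    · exact Or.inr (Or.inl (by exact_mod_cast h))
    · exact Or.inr (Or.inr (by exact_mod_cast h))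
  · have := congrArg (Rat.cast : ℚ → ℚ_[p]) hF
    push_cast at this
    exact this

end Padic

/-! ### The `Ê`-side local kill -/

/-- **`Ê`-side local kill** [cite: Cohen2007NumberTheoryI, Prop. 8.4.8 (3); CohenPazuki2009, Prop. 2.2,
Thm. 4.1]. In `K ∋ θ`, `θ² = -3`, `K = ℚ + ℚθ`: let `Q = (X, Y) ∈ Ê(ℚ)` have descent class `[ε]` with
`2ε = e₁ ± e₂θ`, `e₁² + 3e₂² = 4n³`, `n ≠ 0`, and let `C₁ r³ + C₂ r²t + C₃ rt² + C₄ t³ + C₅ r²v + C₆ t²v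
+ C₇ v³` (`Cᵢ ∈ ℤ`) be a rescaling `c · F(l₁ r, l₂ t, l₃ v)` (`lᵢ ∈ ℚˣ`) of the torsor
`F = e₂(r³ - 9rt²) + e₁(3r²t - 3t³) + 6mn(r² + 3t²)v + 2(81s - 12m³)v³`. If for some prime power `p^k`
the rescaled cubic has no zero in `ZMod (p^k)` with a coordinate equal to `1`, this is absurd:
`[δ(Q)] ≠ [ε]`. -/
theorem ehat_descent_value_ne_of_kill {K : Type*} [Field K] [CharZero K] {θ : K} (hθ : θ ^ 2 = -3)
    (hK : ∀ γ : K, ∃ u v : ℚ, γ = u + v * θ)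
    {m s : ℤ} {W W' : WeierstrassCurve ℚ} (h : IsVeluThreePair (m : ℚ) (s : ℚ) W W')
    {X Y : ℚ} (hQ : W'.toAffine.Nonsingular X Y)
    {ε : K} {e₁ e₂ n : ℤ}
    (hε : 2 * ε = (e₁ : K) + (e₂ : K) * θ ∨ 2 * ε = (e₁ : K) - (e₂ : K) * θ)
    (hn : e₁ ^ 2 + 3 * e₂ ^ 2 = 4 * n ^ 3) (hn0 : n ≠ 0)
    {C₁ C₂ C₃ C₄ C₅ C₆ C₇ : ℤ} {c l₁ l₂ l₃ : ℚ} (hl₁ : l₁ ≠ 0) (hl₂ : l₂ ≠ 0) (hl₃ : l₃ ≠ 0)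
    (hC₁ : (C₁ : ℚ) = c * (e₂ * l₁ ^ 3)) (hC₂ : (C₂ : ℚ) = c * (3 * e₁ * (l₁ ^ 2 * l₂)))
    (hC₃ : (C₃ : ℚ) = c * (-9 * e₂ * (l₁ * l₂ ^ 2))) (hC₄ : (C₄ : ℚ) = c * (-3 * e₁ * l₂ ^ 3))
    (hC₅ : (C₅ : ℚ) = c * (6 * m * n * (l₁ ^ 2 * l₃)))
    (hC₆ : (C₆ : ℚ) = c * (18 * m * n * (l₂ ^ 2 * l₃)))
    (hC₇ : (C₇ : ℚ) = c * (2 * (81 * s - 12 * m ^ 3) * l₃ ^ 3))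
    {p : ℕ} [Fact p.Prime] {k : ℕ}
    (hkill₁ : ∀ t v : ZMod (p ^ k), (C₁ : ZMod (p ^ k)) * 1 ^ 3 + C₂ * (1 ^ 2 * t) + C₃ * (1 * t ^ 2)
      + C₄ * t ^ 3 + C₅ * (1 ^ 2 * v) + C₆ * (t ^ 2 * v) + C₇ * v ^ 3 ≠ 0)
    (hkill₂ : ∀ r v : ZMod (p ^ k), (C₁ : ZMod (p ^ k)) * r ^ 3 + C₂ * (r ^ 2 * 1) + C₃ * (r * 1 ^ 2)
      + C₄ * 1 ^ 3 + C₅ * (r ^ 2 * v) + C₆ * (1 ^ 2 * v) + C₇ * v ^ 3 ≠ 0)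
    (hkill₃ : ∀ r t : ZMod (p ^ k), (C₁ : ZMod (p ^ k)) * r ^ 3 + C₂ * (r ^ 2 * t) + C₃ * (r * t ^ 2)
      + C₄ * t ^ 3 + C₅ * (r ^ 2 * 1) + C₆ * (t ^ 2 * 1) + C₇ * 1 ^ 3 ≠ 0)
    (hcl : cubeClass ((Y : K) - θ * (((m : ℚ) : K) * ((X : K) + 4 * ((m : ℚ) : K) ^ 2 / 3)
          + (27 * ((s : ℚ) : K) - 4 * ((m : ℚ) : K) ^ 3) / 9)) = cubeClass ε) : False := by
  -- the rescaled value `27 δ = Y₂ - θ L₂`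
  set Y₂ : ℚ := 27 * Y with hY₂
  set X₂ : ℚ := 9 * X + 12 * (m : ℚ) ^ 2 with hX₂
  set L₂ : ℚ := 3 * m * X₂ + (81 * s - 12 * (m : ℚ) ^ 3) with hL₂
  have hv27 : (27 : K) * ((Y : K) - θ * (((m : ℚ) : K) * ((X : K) + 4 * ((m : ℚ) : K) ^ 2 / 3)
      + (27 * ((s : ℚ) : K) - 4 * ((m : ℚ) : K) ^ 3) / 9)) = (Y₂ : K) + ((-L₂ : ℚ) : K) * θ := by
    rw [hY₂, hL₂, hX₂, descent_Ehat_rescale]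
    push_cast
    ring
  -- the curve equation `Y₂² + 3 L₂² = X₂³`
  have hE := (h.equation'_iff X Y).mp hQ.left
  have hE' : Y₂ ^ 2 + 3 * L₂ ^ 2 = X₂ ^ 3 := by
    rw [hY₂, hL₂, hX₂]; linear_combination (729 : ℚ) * hE
  -- `27 δ ≠ 0` (else `X₂ = 0` and `81 s = 12 m³`)
  have hv0 : (Y₂ : K) + ((-L₂ : ℚ) : K) * θ ≠ 0 := by
    intro h0
    obtain ⟨hY0, hL0⟩ := rat_coords_eq_zero hθ h0
    have hX0 : X₂ = 0 := by
      have : X₂ ^ 3 = 0 := by rw [← hE', hY0]; linear_combination (-3 : ℚ) * L₂ * hL0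
      exact (pow_eq_zero_iff (n := 3) (by norm_num)).mp this
    apply h.disc_ne
    have : (81 * s - 12 * (m : ℚ) ^ 3) = 0 := by
      have := hL0; rw [neg_eq_zero, hL₂, hX0] at this; linear_combination this
    linear_combination (-1 / 3 : ℚ) * this
  -- the sign `σ = ±1` of `e₂`
  obtain ⟨σ, hσ, hεσ⟩ : ∃ σ : ℤ, (σ = 1 ∨ σ = -1) ∧ 2 * ε = (e₁ : K) + ((σ * e₂ : ℤ) : K) * θ := by
    rcases hε with hε | hε
    · exact ⟨1, Or.inl rfl, by rw [one_mul]; exact hε⟩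
    · exact ⟨-1, Or.inr rfl, by push_cast; linear_combination hε⟩
  have hσ2 : (σ : ℚ) ^ 2 = 1 := by rcases hσ with rfl | rfl <;> norm_num
  have hσ3 : (σ : ℚ) ^ 3 = σ := by rcases hσ with rfl | rfl <;> norm_num
  -- `ε ≠ 0` (else `e₁ = e₂ = 0`, `n = 0`)
  have hε0 : ε ≠ 0 := by
    rintro rfl
    obtain ⟨h1, h2⟩ := rat_coords_eq_zero hθ (u := e₁) (v := σ * e₂)
      (by push_cast at hεσ ⊢; linear_combination -hεσ)
    have he₁ : e₁ = 0 := by exact_mod_cast h1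
    have he₂ : e₂ = 0 := by
      have hσ0 : (σ : ℚ) ≠ 0 := by rcases hσ with rfl | rfl <;> norm_num
      exact_mod_cast (mul_eq_zero.mp h2).resolve_left hσ0
    rw [he₁, he₂] at hn
    have h4 : (4 : ℤ) * n ^ 3 = 0 := by linear_combination -hn
    exact hn0 ((pow_eq_zero_iff (n := 3) (by norm_num)).mp ((mul_eq_zero.mp h4).resolve_left (by norm_num)))
  -- `27 δ = ε w³`, `w = r + tθ`
  have hcl27 : cubeClass ((Y₂ : K) + ((-L₂ : ℚ) : K) * θ) = cubeClass ε := by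
    rw [← hv27, cubeClass_twentySeven_mul]; exact hcl
  obtain ⟨w, hw0, hw⟩ := (cubeClass_eq_cubeClass_iff hv0 hε0).mp hcl27
  obtain ⟨r, t, rfl⟩ := hK w
  have hcube := cube_rat_coords hθ r t
  have hnQ : (e₁ : ℚ) ^ 2 + 3 * (e₂ : ℚ) ^ 2 = 4 * (n : ℚ) ^ 3 := by exact_mod_cast hn
  -- comparing coordinates of `2 · 27δ = (e₁ + σ e₂ θ)(R + T θ)`
  have key : ((2 * Y₂ : ℚ) : K) + ((-2 * L₂ : ℚ) : K) * θ =
      ((e₁ * (r ^ 3 - 9 * r * t ^ 2) - 3 * (σ * e₂) * (3 * r ^ 2 * t - 3 * t ^ 3) : ℚ) : K)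
        + ((e₁ * (3 * r ^ 2 * t - 3 * t ^ 3) + (σ * e₂) * (r ^ 3 - 9 * r * t ^ 2) : ℚ) : K) * θ := by
    push_cast at hεσ hcube hw ⊢
    linear_combination (2 : K) * hw + 2 * ε * hcube
      + (((r : K) ^ 3 - 9 * r * t ^ 2) + (3 * (r : K) ^ 2 * t - 3 * t ^ 3) * θ) * hεσ
      + (σ : K) * e₂ * (3 * (r : K) ^ 2 * t - 3 * t ^ 3) * hθ
  obtain ⟨h1, h2⟩ := rat_coords_eq hθ key
  -- norms: `X₂³ = (n (r² + 3t²))³`, hence `X₂ = n (r² + 3t²)`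
  have hX3 : X₂ ^ 3 = (n * (r ^ 2 + 3 * t ^ 2)) ^ 3 := by
    have hY : (2 * Y₂) ^ 2
        = (e₁ * (r ^ 3 - 9 * r * t ^ 2) - 3 * (σ * e₂) * (3 * r ^ 2 * t - 3 * t ^ 3)) ^ 2 := by
      rw [h1]
    have hL : (2 * L₂) ^ 2
        = (e₁ * (3 * r ^ 2 * t - 3 * t ^ 3) + (σ * e₂) * (r ^ 3 - 9 * r * t ^ 2)) ^ 2 := by
      rw [← h2]; ring
    have hab : (e₁ * (r ^ 3 - 9 * r * t ^ 2) - 3 * (σ * e₂) * (3 * r ^ 2 * t - 3 * t ^ 3)) ^ 2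
        + 3 * (e₁ * (3 * r ^ 2 * t - 3 * t ^ 3) + (σ * e₂) * (r ^ 3 - 9 * r * t ^ 2)) ^ 2
        = 4 * (n : ℚ) ^ 3 * (r ^ 2 + 3 * t ^ 2) ^ 3 := by
      have : (e₁ * (r ^ 3 - 9 * r * t ^ 2) - 3 * (σ * e₂) * (3 * r ^ 2 * t - 3 * t ^ 3)) ^ 2
          + 3 * (e₁ * (3 * r ^ 2 * t - 3 * t ^ 3) + (σ * e₂) * (r ^ 3 - 9 * r * t ^ 2)) ^ 2
          = ((e₁ : ℚ) ^ 2 + 3 * ((σ : ℚ) ^ 2 * (e₂ : ℚ) ^ 2)) * (r ^ 2 + 3 * t ^ 2) ^ 3 := by ring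
      rw [this, hσ2, one_mul, hnQ]
    linear_combination (-1 : ℚ) * hE' + (1 / 4 : ℚ) * hY + (3 / 4 : ℚ) * hL + (1 / 4 : ℚ) * hab
  have hX : X₂ = n * (r ^ 2 + 3 * t ^ 2) := (Odd.strictMono_pow (by decide : Odd 3)).injective hX3
  -- the torsor point `(σ r, t, 1)` on `F`
  rw [hL₂, hX] at h2
  have hF0 : (e₂ : ℚ) * (σ * r) ^ 3 + 3 * e₁ * ((σ * r) ^ 2 * t) + (-9 * e₂) * ((σ * r) * t ^ 2)
      + (-3 * e₁) * t ^ 3 + 6 * m * n * ((σ * r) ^ 2 * 1) + 18 * m * n * (t ^ 2 * 1)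
      + 2 * (81 * s - 12 * m ^ 3) * 1 ^ 3 = 0 := by
    linear_combination (e₂ : ℚ) * r ^ 3 * hσ3 + (3 * e₁ * r ^ 2 * t + 6 * m * n * r ^ 2) * hσ2 - h2
  -- … i.e. `(σ r / l₁, t / l₂, 1 / l₃)` on the rescaled cubic
  have hF : (C₁ : ℚ) * (σ * r / l₁) ^ 3 + C₂ * ((σ * r / l₁) ^ 2 * (t / l₂))
      + C₃ * ((σ * r / l₁) * (t / l₂) ^ 2) + C₄ * (t / l₂) ^ 3 + C₅ * ((σ * r / l₁) ^ 2 * (1 / l₃))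
      + C₆ * ((t / l₂) ^ 2 * (1 / l₃)) + C₇ * (1 / l₃) ^ 3 = 0 := by
    rw [hC₁, hC₂, hC₃, hC₄, hC₅, hC₆, hC₇]
    field_simp
    linear_combination c * hF0
  have hne : σ * r / l₁ ≠ 0 ∨ t / l₂ ≠ 0 ∨ 1 / l₃ ≠ 0 := Or.inr (Or.inr (one_div_ne_zero hl₃))
  obtain ⟨a, b, c', h1', habc⟩ := exists_zmod_solution₇ (p := p) k hne hF
  rcases h1' with rfl | rfl | rfl
  · exact hkill₁ b c' habc
  · exact hkill₂ a c' habc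
  · exact hkill₃ a b habc

end Summit.BirchSwinnertonDyer.BirchSwinnertonDyer.Rank2Observatory.ThreeIso

end
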